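import Literature.MathematicalPhysics.QuantumLattice.HubbardNNNHoppingFluxGaugeFunction
import Mathlib.Analysis.SpecialFunctions.Complex.CircleAddChar
import HarnessLib

/-!
# The `t–t'` Hubbard torus in a UNIFORM ORBITAL MAGNETIC FIELD: plaquette flux `2πm/L` in the
# Landau gauge (`hubbardTorusTT'Plaquette`), its sector energy, and the first bookkeeping

Topic `Literature/MathematicalPhysics/QuantumLattice` (namespace = path; family `hubbard`). Companion of
`MagneticHubbardTorus(Gauge).lean` (the nearest-neighbour Hubbard torus `magneticHubbardTorus L A t U` in an
arbitrary lattice `U(1)` gauge field `A`, gauge covariance, sector-energy invariance),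
`HubbardNNNHoppingFlux.lean` (the diagonal Peierls bond sum `diagPeierlsHopping L a`, the HANDLE-flux torus
`hubbardTorusTT'Flux`) and `HubbardNNNHoppingFluxStiffness/…GaugeFunction.lean` (site-phase conjugation of
the diagonal bonds). Those files thread an Aharonov–Bohm flux through a CYCLE of the torus (every plaquette
flat); this file puts a uniform flux through every PLAQUETTE — the Harper–Hofstadter–Hubbard torus — the
object `D1` of the Hubbard cuprate cell's row class T6 «certified orbital-flux energy cost»
(`hubbard-cq`, cards `orbital-flux-condensation-cost` / `orbital-flux-vortex-entry-chord`).

## The object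

On the `L × L` torus the Landau gauge `A_{x→x+e₂} = χ(m·x₁)`, `A_{x→x+e₁} = 1`, with `χ = ZMod.toCircle`
the standard additive character `j ↦ e^{2πi j/L}` of `ℤ/L` and `m : ℤ`, is single valued and carries the
SAME holonomy `χ(m) = e^{2πi m/L}` around every plaquette: flux `Φ = 2πm/L` per plaquette, `mL` flux
quanta through the torus (these are exactly the uniform fluxes a plain Landau gauge supports on the
`L`-torus; the cell's `Φ = 2πp/q` with `q ∣ L` is `m = pL/q`). The next-nearest-neighbour bond
`x → x + j_s` (`j₀ = e₁ + e₂`, `j₁ = e₁ − e₂`) carries the straight-line Peierls phase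
`e^{±iΦ(x₁ + ½)} = (χ(m x₁)·η)^{±1}`, `η = e^{iπm/L}` the half-flux phase (`η² = χ(m)`), so each of the two
triangles cut by a diagonal carries half the plaquette flux. Written with the character `χ` (additive in
`ℤ/L`), no `val`-wrap bookkeeping is needed anywhere.

## Contents (all PROVED; the four `def`s are the only new objects)

* `halfFluxPhase L m = e^{iπm/L}`, `halfFluxPhase_mul_self : η·η = χ(m)`.
* `landauGauge L m : GaugeConfig 2 L Circle`, `landauDiagAmp L m : Fin 2 → Site 2 L → ℂ`,
  **`hubbardTorusTT'Plaquette L t' U m := magneticHubbardTorus L (landauGauge L m) 1 U − t'·D_{landauDiagAmp}`**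
  (`t = 1`), and the sector energy `plaquetteFluxEnergyTT' L t' U δ m` (`N = 2⌊(1−δ)L²/2⌋`, `S^z = 0`, the
  convention of `fluxEnergyTT'`).
* UNIFORM FLUX: `u1Plaquette_landauGauge : u1Plaquette (landauGauge L m) x = χ(m)` for EVERY plaquette `x`;
  `coe_u1Plaquette_landauGauge : … = exp(2πi m/L)`; half-flux split of the diagonals
  (`landauDiagAmp_zero_eq`, `landauDiagAmp_one_eq`).
* ZERO FIELD: `landauGauge_zero = 1`, `landauDiagAmp_zero`, `hubbardTorusTT'Plaquette_zero` (`= hubbardTorusTT' L 1 t' U`,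
  `L ≥ 3`), `plaquetteFluxEnergyTT'_zero = fluxEnergyTT' L t' U δ 0`.
* SYMMETRIES: Hermitian; conserves `N↑, N↓` (`preservesSectors_diagPeierlsHopping`, `…_hubbardTorusTT'Plaquette`,
  commutes with `N` and `S^z`); TIME REVERSAL `conj H(m) = H(−m)` (`magneticHubbardTorus_map_conj`,
  `diagPeierlsHopping_map_conj`, `hubbardTorusTT'Plaquette_map_conj`) hence **`E(−m) = E(m)` in every sector**
  (`minEnergyOn_hubbardTorusTT'Plaquette_neg`, `plaquetteFluxEnergyTT'_neg`) — FL2 of the card.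
* The gauge equivalence of the two Landau gauges and the magnetic translations (FL1) are the companion file
  `HubbardNNNHoppingPlaquetteFluxGauge.lean`.

HONEST SCOPE: definitions and symmetry bookkeeping of a finite-volume operator; no number, no
thermodynamic limit (FL4), nothing about superconductivity. The `m ↦ m + L` periodicity holds for the
nearest-neighbour part only (the diagonal half-flux phases change sign), as for any straight-line Peierls
substitution with next-nearest-neighbour bonds; it is deliberately not stated.

## References
* D. R. Hofstadter, Phys. Rev. B 14 (1976) 2239, §II (Landau gauge on the square lattice, flux `2πp/q` per
  plaquette, magnetic cell `q × 1`). [cite: Hofstadter1976, §II]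
* E. H. Lieb, PRL 73 (1994) 2158, eqs. (1)–(2) (Peierls phases `t_{xy} = |t_{xy}|e^{iφ(x,y)}`, flux through a
  circuit; gauge invariance). [cite: Lieb1994, eqs. (1)-(2)]
* J. Zak, Phys. Rev. 134 (1964) A1602 (magnetic translations). [cite: Zak1964, §2]
* N. Byers, C. N. Yang, PRL 7 (1961) 46 (`E(−Φ) = E(Φ)` by time reversal). [cite: ByersYang1961]
* H. Watanabe, J. Stat. Phys. 177 (2019) 717, §2.2.1 (site-phase unitaries `U H U†`). [cite: Watanabe2019, §2.2.1]
-/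

noncomputable section

namespace Literature.MathematicalPhysics.QuantumLattice

open _root_.Matrix Finset Literature.MathematicalPhysics.QuantumFieldTheory HubbardWave0
open Literature.Barriers.QuantumFields (u1Plaquette)
open scoped ComplexConjugate Real

variable (L : ℕ) [NeZero L]

/-! ### The Landau gauge and the diagonal Peierls phases -/

/-- The **half-flux phase** `η_m = e^{iπm/L}` (`η_m² = e^{2πi m/L} = χ(m)`): the Peierls phase of half a
plaquette, picked up by a straight diagonal bond. [cite: Hofstadter1976, §II] -/
def halfFluxPhase (m : ℤ) : Circle := Circle.exp (π * m / L)

/-- The **Landau gauge field with flux `2πm/L` per plaquette** on the torus `(ℤ/L)²`: the character value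
`χ(m·x₁) = e^{2πi m x₁/L}` on every `e₂`-edge `(x, x + e₂)`, `1` on the `e₁`-edges (Hofstadter's
`A = (0, Bx)`; single valued because `χ` is a character of `ℤ/L`). [cite: Hofstadter1976, §II] -/
def landauGauge (m : ℤ) : GaugeConfig 2 L Circle :=
  fun e => if e.2 = 1 then ZMod.toCircle ((m : ZMod L) * e.1 0) else 1

/-- The **straight-line Peierls amplitudes of the diagonal bonds in the Landau gauge**: the bond
`x → x + j₀ = x + e₁ + e₂` carries `χ(m x₁)·η_m = e^{iΦ(x₁+½)}`, the bond `x → x + j₁ = x + e₁ − e₂` its inverse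
`e^{−iΦ(x₁+½)}` (`Φ = 2πm/L`; the line integral of `A = (0, Φx₁)` along the bond), so that each triangle
cut off by a diagonal carries the flux `Φ/2`. [cite: Lieb1994, eqs. (1)-(2)] -/
def landauDiagAmp (m : ℤ) : Fin 2 → Site 2 L → ℂ :=
  fun s x => if s = 0 then ((ZMod.toCircle ((m : ZMod L) * x 0) * halfFluxPhase L m : Circle) : ℂ)
    else (((ZMod.toCircle ((m : ZMod L) * x 0) * halfFluxPhase L m)⁻¹ : Circle) : ℂ)

/-- **The `t–t'` Hubbard torus in the uniform orbital field of flux `2πm/L` per plaquette** (`t = 1`, Landau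
gauge): the Peierls-coupled nearest-neighbour Hubbard torus `magneticHubbardTorus L (landauGauge L m) 1 U`
plus the diagonal hopping `−t' Σ [a_s(x) c†_{x+j_s,σ}c_{x,σ} + h.c.]` with the straight-line phases
`landauDiagAmp`. At `m = 0` and `L ≥ 3` it is `hubbardTorusTT' L 1 t' U` (`hubbardTorusTT'Plaquette_zero`).
[cite: Hofstadter1976, §II] -/
def hubbardTorusTT'Plaquette (t' U : ℝ) (m : ℤ) :
    Matrix (Finset (Orb (FermionTorus 2 L))) (Finset (Orb (FermionTorus 2 L))) ℂ :=
  magneticHubbardTorus L (landauGauge L m) 1 U + -(t' : ℂ) • diagPeierlsHopping L (landauDiagAmp L m)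

/-- The **sector energy of the `t–t'` torus in the orbital field**: the lowest energy of
`hubbardTorusTT'Plaquette L t' U m` in the joint sector `N_L = 2⌊(1−δ)L²/2⌋`, `S^z = 0` (the convention of
`fluxEnergyTT'`); its increment over `m = 0` is the orbital-flux energy cost of the cell's row T6.
[cite: Hofstadter1976, §II] -/
def plaquetteFluxEnergyTT' (t' U δ : ℝ) (m : ℤ) : ℝ :=
  (hubbardTorusTT'Plaquette L t' U m).minEnergyOn (szSector (2 * ⌊(1 - δ) * (L : ℝ) ^ 2 / 2⌋₊) 0)

/-! ### Elementary identities -/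

/-- `η_m · η_m = χ(m)`: two half fluxes make a plaquette flux. [cite: Hofstadter1976, §II] -/
theorem halfFluxPhase_mul_self (m : ℤ) :
    halfFluxPhase L m * halfFluxPhase L m = ZMod.toCircle (m : ZMod L) := by
  ext
  unfold halfFluxPhase
  rw [Circle.coe_mul, Circle.coe_exp, ← Complex.exp_add, ZMod.toCircle_intCast]
  congr 1
  push_cast
  ring

omit [NeZero L] in
/-- `η_{−m} = η_m⁻¹`. [cite: ByersYang1961] -/
theorem halfFluxPhase_neg (m : ℤ) : halfFluxPhase L (-m) = (halfFluxPhase L m)⁻¹ := by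
  unfold halfFluxPhase
  rw [← Circle.exp_neg]
  congr 1
  push_cast
  ring

omit [NeZero L] in
/-- `η_0 = 1`. [cite: Hofstadter1976, §II] -/
theorem halfFluxPhase_zero : halfFluxPhase L 0 = 1 := by
  unfold halfFluxPhase
  rw [Int.cast_zero, mul_zero, zero_div, Circle.exp_zero]

/-- The Landau field on an `e₁`-edge is trivial. [cite: Hofstadter1976, §II] -/
@[simp] theorem landauGauge_apply_zero (m : ℤ) (x : Site 2 L) : landauGauge L m (x, 0) = 1 := by
  simp [landauGauge]

/-- The Landau field on the `e₂`-edge at `x` is `χ(m x₁)`. [cite: Hofstadter1976, §II] -/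
@[simp] theorem landauGauge_apply_one (m : ℤ) (x : Site 2 L) :
    landauGauge L m (x, 1) = ZMod.toCircle ((m : ZMod L) * x 0) := by
  simp [landauGauge]

omit [NeZero L] in
/-- The `e₁`-shift moves `x₁` by one. [folklore] -/
private theorem shift_zero_apply_zero' (x : Site 2 L) : (x.shift 0) 0 = x 0 + 1 := by simp [Site.shift]

omit [NeZero L] in
/-- The `e₂`-shift fixes `x₁`. [folklore] -/
private theorem shift_one_apply_zero' (x : Site 2 L) : (x.shift 1) 0 = x 0 := by simp [Site.shift]

omit [NeZero L] in
/-- The `e₁`-shift fixes `x₂`. [folklore] -/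
private theorem shift_zero_apply_one (x : Site 2 L) : (x.shift 0) 1 = x 1 := by simp [Site.shift]

omit [NeZero L] in
/-- The `e₂`-shift moves `x₂` by one. [folklore] -/
private theorem shift_one_apply_one (x : Site 2 L) : (x.shift 1) 1 = x 1 + 1 := by simp [Site.shift]

omit [NeZero L] in
/-- Both diagonal jumps move `x₁` by `+1`. [folklore] -/
private theorem add_torusDiagJump_apply_zero (x : Site 2 L) (s : Fin 2) : (x + torusDiagJump L s) 0 = x 0 + 1 := by
  simp [torusDiagJump]

omit [NeZero L] in
/-- The jump `j₀` moves `x₂` by `+1`. [folklore] -/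
private theorem add_torusDiagJump_zero_apply_one (x : Site 2 L) : (x + torusDiagJump L 0) 1 = x 1 + 1 := by
  simp [torusDiagJump]

omit [NeZero L] in
/-- The jump `j₁` moves `x₂` by `−1`. [folklore] -/
private theorem add_torusDiagJump_one_apply_one (x : Site 2 L) : (x + torusDiagJump L 1) 1 = x 1 - 1 := by
  simp [torusDiagJump, sub_eq_add_neg]

/-! ### Uniform flux: every plaquette carries `χ(m) = e^{2πi m/L}` -/

/-- **Uniform plaquette flux**: the holonomy of the Landau field around EVERY plaquette is
`χ(m) = e^{2πi m/L}` (`χ(m(x₁+1))·χ(m x₁)⁻¹`, additivity of the character). [cite: Hofstadter1976, §II] -/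
theorem u1Plaquette_landauGauge (m : ℤ) (x : Site 2 L) :
    u1Plaquette (landauGauge L m) x = ZMod.toCircle (m : ZMod L) := by
  rw [u1Plaquette, plaquetteHolonomy, landauGauge_apply_zero, landauGauge_apply_one, landauGauge_apply_zero,
    landauGauge_apply_one, shift_zero_apply_zero', one_mul, inv_one, mul_one, ← AddChar.map_neg_eq_inv,
    ← AddChar.map_add_eq_mul, show (m : ZMod L) * (x 0 + 1) + -((m : ZMod L) * x 0) = m by ring]

/-- In `ℂ`: the plaquette holonomy is `exp(2πi m/L)`. [cite: Hofstadter1976, §II] -/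
theorem coe_u1Plaquette_landauGauge (m : ℤ) (x : Site 2 L) :
    (u1Plaquette (landauGauge L m) x : ℂ) = Complex.exp (2 * π * Complex.I * m / L) := by
  rw [u1Plaquette_landauGauge, ZMod.toCircle_intCast]

/-- The cell's parametrisation: for `q ∣ L` the choice `m = p·(L/q)` gives the flux `2πp/q` per plaquette,
`exp(2πi p/q)`. [cite: Hofstadter1976, §II] -/
theorem coe_u1Plaquette_landauGauge_of_dvd (p : ℤ) {q : ℕ} (hq0 : q ≠ 0) (hq : q ∣ L) (x : Site 2 L) :
    (u1Plaquette (landauGauge L (p * ((L / q : ℕ) : ℤ))) x : ℂ) = Complex.exp (2 * π * Complex.I * p / q) := by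
  rw [coe_u1Plaquette_landauGauge]
  obtain ⟨k, hk⟩ := hq
  have hk0 : k ≠ 0 := by
    rintro rfl
    exact (NeZero.ne L) (by simpa using hk)
  have hLq : (L / q : ℕ) = k := by rw [hk, Nat.mul_div_cancel_left k (Nat.pos_of_ne_zero hq0)]
  rw [hLq]
  subst hk
  congr 1
  push_cast
  have hq' : (q : ℂ) ≠ 0 := Nat.cast_ne_zero.2 hq0
  have hk' : (k : ℂ) ≠ 0 := Nat.cast_ne_zero.2 hk0
  field_simp

/-- The `j₀` amplitude, unfolded. [cite: Lieb1994, eqs. (1)-(2)] -/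
theorem landauDiagAmp_zero_apply (m : ℤ) (x : Site 2 L) :
    landauDiagAmp L m 0 x = ((ZMod.toCircle ((m : ZMod L) * x 0) * halfFluxPhase L m : Circle) : ℂ) := by
  simp [landauDiagAmp]

/-- The `j₁` amplitude, unfolded. [cite: Lieb1994, eqs. (1)-(2)] -/
theorem landauDiagAmp_one_apply (m : ℤ) (x : Site 2 L) :
    landauDiagAmp L m 1 x = (((ZMod.toCircle ((m : ZMod L) * x 0) * halfFluxPhase L m)⁻¹ : Circle) : ℂ) := by
  simp [landauDiagAmp]

/-- **Half-flux split, `j₀`**: the diagonal amplitude times `η_m` is the two-edge path amplitude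
`A_{x,e₁} A_{x+e₁,e₂} = χ(m(x₁+1))`: the triangle `(x, x+e₁, x+e₁+e₂)` carries `η_m = e^{iΦ/2}`.
[cite: Lieb1994, eqs. (1)-(2)] -/
theorem landauDiagAmp_zero_eq (m : ℤ) (x : Site 2 L) :
    landauDiagAmp L m 0 x * (halfFluxPhase L m : ℂ) =
      ((landauGauge L m (x, 0) * landauGauge L m (x.shift 0, 1) : Circle) : ℂ) := by
  rw [landauDiagAmp_zero_apply, landauGauge_apply_zero, landauGauge_apply_one, shift_zero_apply_zero', one_mul,
    ← Circle.coe_mul, mul_assoc, halfFluxPhase_mul_self, ← AddChar.map_add_eq_mul,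
    show (m : ZMod L) * x 0 + m = m * (x 0 + 1) by ring]

/-- **Half-flux split, `j₁`**: the amplitude `a₁(x)` of `x → x + e₁ − e₂` satisfies
`a₁(x) · χ(m(x₁+1)) = η_m`, i.e. the triangle `(x, x+e₁, x+e₁−e₂)` carries half a plaquette flux.
[cite: Lieb1994, eqs. (1)-(2)] -/
theorem landauDiagAmp_one_eq (m : ℤ) (x : Site 2 L) :
    landauDiagAmp L m 1 x * ((ZMod.toCircle ((m : ZMod L) * (x 0 + 1)) : Circle) : ℂ) = (halfFluxPhase L m : ℂ) := by
  rw [landauDiagAmp_one_apply, ← Circle.coe_mul]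
  congr 1
  rw [mul_add, mul_one, AddChar.map_add_eq_mul, ← halfFluxPhase_mul_self]
  group

/-! ### Zero field -/

/-- The Landau field of flux zero is the trivial gauge field. [cite: Hofstadter1976, §II] -/
theorem landauGauge_zero : landauGauge L 0 = 1 := by
  funext e
  show landauGauge L 0 e = 1
  unfold landauGauge
  split_ifs
  · rw [Int.cast_zero, zero_mul, AddChar.map_zero_eq_one]
  · rfl

/-- At flux zero the diagonal amplitudes are `1`. [cite: Hofstadter1976, §II] -/
theorem landauDiagAmp_zero (s : Fin 2) (x : Site 2 L) : landauDiagAmp L 0 s x = 1 := by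
  simp only [landauDiagAmp, Int.cast_zero, zero_mul, AddChar.map_zero_eq_one, halfFluxPhase_zero, one_mul, inv_one,
    Circle.coe_one, ite_self]

/-- **At flux zero the object is the tree's `t–t'` torus** (`L ≥ 3`):
`hubbardTorusTT'Plaquette L t' U 0 = hubbardTorusTT' L 1 t' U`. [cite: XuEtAl2024, eq. (1)] -/
theorem hubbardTorusTT'Plaquette_zero (hL : 3 ≤ L) (t' U : ℝ) :
    hubbardTorusTT'Plaquette L t' U 0 = hubbardTorusTT' L 1 t' U := by
  rw [hubbardTorusTT'Plaquette, landauGauge_zero, hubbardTorusTT'_eq_magneticHubbardTorus_add_diag hL,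
    show landauDiagAmp L 0 = fun _ _ => (1 : ℂ) from funext fun s => funext fun x => landauDiagAmp_zero L s x]

/-- At flux zero the sector energy is the untwisted `t–t'` flux envelope `fluxEnergyTT' L t' U δ 0` (`L ≥ 3`).
[cite: ScalapinoWhiteZhang1993, §II] -/
theorem plaquetteFluxEnergyTT'_zero (hL : 3 ≤ L) (t' U δ : ℝ) :
    plaquetteFluxEnergyTT' L t' U δ 0 = fluxEnergyTT' L t' U δ 0 := by
  rw [plaquetteFluxEnergyTT', hubbardTorusTT'Plaquette_zero L hL, fluxEnergyTT', hubbardTorusTT'Flux_zero]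

/-! ### Hermiticity and conserved charges -/

/-- `hubbardTorusTT'Plaquette` is Hermitian (unitary phases, real `t', U`). [cite: Lieb1994, eqs. (1)-(2)] -/
theorem isHermitian_hubbardTorusTT'Plaquette (t' U : ℝ) (m : ℤ) :
    (hubbardTorusTT'Plaquette L t' U m).IsHermitian := by
  refine (magneticHubbardTorus_isHermitian (landauGauge L m) 1 U).add ?_
  unfold Matrix.IsHermitian
  rw [conjTranspose_smul, (isHermitian_diagPeierlsHopping L (landauDiagAmp L m)).eq, star_neg, Complex.star_def,
    Complex.conj_ofReal]

/-- A diagonal Peierls bond sum conserves `N↑` and `N↓` (spin-diagonal hoppings). The same statement is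
proved in the Hubbard ladder tree as `Summit.HubbardSuperconductivity.HubbardLadder.Bounds.preservesSectors_diagPeierlsHopping'`
(`CurrentOperatorTTPrime.lean`); restated at Literature level so that Literature files can use it.
[cite: Lieb1994, eqs. (1)-(2)] -/
theorem preservesSectors_diagPeierlsHopping (a : Fin 2 → Site 2 L → ℂ) :
    PreservesSectors (diagPeierlsHopping L a) :=
  PreservesSectors.sum fun _ _ => PreservesSectors.sum fun _ _ => PreservesSectors.sum fun σ _ =>
    ((LiebThm1.preservesSectors_hopping _ _ σ).smul _).add ((LiebThm1.preservesSectors_hopping _ _ σ).smul _)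

/-- `hubbardTorusTT'Plaquette` conserves `N↑` and `N↓`. [cite: Lieb1994, eqs. (1)-(2)] -/
theorem preservesSectors_hubbardTorusTT'Plaquette (t' U : ℝ) (m : ℤ) :
    PreservesSectors (hubbardTorusTT'Plaquette L t' U m) :=
  (preservesSectors_magneticHubbardTorus (landauGauge L m) 1 U).add
    ((preservesSectors_diagPeierlsHopping L (landauDiagAmp L m)).smul _)

/-- `[H, N] = 0` for the torus in the orbital field. [cite: Lieb1994, eqs. (1)-(2)] -/
theorem hubbardTorusTT'Plaquette_commute_totalNumber (t' U : ℝ) (m : ℤ) :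
    Commute (hubbardTorusTT'Plaquette L t' U m) totalNumber := by
  rw [LiebThm1.totalNumber_eq_diagonal]
  exact (preservesSectors_hubbardTorusTT'Plaquette L t' U m).commute_diagonal fun a b => ((a + b : ℕ) : ℂ)

/-- `[H, S^z] = 0` for the torus in the orbital field (spin-independent phases). [cite: Lieb1994, eqs. (1)-(2)] -/
theorem hubbardTorusTT'Plaquette_commute_spinZ (t' U : ℝ) (m : ℤ) :
    Commute (hubbardTorusTT'Plaquette L t' U m) HubbardWave0.spinZ := by
  rw [LiebThm1.spinZ_eq_diagonal]
  exact (preservesSectors_hubbardTorusTT'Plaquette L t' U m).commute_diagonal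
    fun a b => (1 / 2 : ℂ) * ((a : ℂ) - (b : ℂ))

/-! ### Time reversal: `conj H(m) = H(−m)`, `E(−m) = E(m)` -/

/-- **Complex conjugation inverts the gauge field of the Peierls torus**:
`conj H_A(t,U) = H_{A⁻¹}(t,U)` entrywise (real Jordan–Wigner matrices). [cite: ByersYang1961] -/
theorem magneticHubbardTorus_map_conj (A : GaugeConfig 2 L Circle) (t U : ℝ) :
    (magneticHubbardTorus L A t U).map (starRingEnd ℂ) = magneticHubbardTorus L A⁻¹ t U := by
  unfold magneticHubbardTorus
  rw [Matrix.map_add _ (map_add _), map_conj_smul, map_conj_smul]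
  simp only [map_conj_sum, Matrix.map_add _ (map_add _), map_conj_smul, Matrix.map_mul, creation_map_conj,
    annihilation_map_conj, numberOp, map_neg, Complex.conj_ofReal, Complex.conj_conj, Pi.inv_apply,
    Circle.coe_inv_eq_conj]

/-- **Complex conjugation conjugates the diagonal Peierls amplitudes.** [cite: ByersYang1961] -/
theorem diagPeierlsHopping_map_conj (a : Fin 2 → Site 2 L → ℂ) :
    (diagPeierlsHopping L a).map (starRingEnd ℂ) = diagPeierlsHopping L (fun s x => conj (a s x)) := by
  unfold diagPeierlsHopping
  simp only [map_conj_sum, Matrix.map_add _ (map_add _), map_conj_smul, Matrix.map_mul, creation_map_conj,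
    annihilation_map_conj, Complex.conj_conj]

/-- Reversing the flux inverts the Landau field: `landauGauge L (−m) = (landauGauge L m)⁻¹`. [cite: ByersYang1961] -/
theorem landauGauge_neg (m : ℤ) : landauGauge L (-m) = (landauGauge L m)⁻¹ := by
  funext e
  simp only [landauGauge, Pi.inv_apply]
  split_ifs
  · rw [Int.cast_neg, neg_mul, AddChar.map_neg_eq_inv]
  · rw [inv_one]

/-- Reversing the flux conjugates the diagonal amplitudes. [cite: ByersYang1961] -/
theorem landauDiagAmp_neg (m : ℤ) : landauDiagAmp L (-m) = fun s x => conj (landauDiagAmp L m s x) := by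
  funext s x
  by_cases hs : s = 0
  · subst hs
    rw [landauDiagAmp_zero_apply, landauDiagAmp_zero_apply, ← Circle.coe_inv_eq_conj, halfFluxPhase_neg, Int.cast_neg,
      neg_mul, AddChar.map_neg_eq_inv, mul_inv]
  · obtain rfl : s = 1 := Fin.eq_one_of_ne_zero s hs
    rw [landauDiagAmp_one_apply, landauDiagAmp_one_apply, ← Circle.coe_inv_eq_conj, inv_inv, halfFluxPhase_neg,
      Int.cast_neg, neg_mul, AddChar.map_neg_eq_inv, mul_inv, inv_inv, inv_inv]

/-- **Time reversal**: `conj H(m) = H(−m)` entrywise for the torus in the orbital field. [cite: ByersYang1961] -/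
theorem hubbardTorusTT'Plaquette_map_conj (t' U : ℝ) (m : ℤ) :
    (hubbardTorusTT'Plaquette L t' U m).map (starRingEnd ℂ) = hubbardTorusTT'Plaquette L t' U (-m) := by
  rw [hubbardTorusTT'Plaquette, hubbardTorusTT'Plaquette, Matrix.map_add _ (map_add _), magneticHubbardTorus_map_conj,
    map_conj_smul, diagPeierlsHopping_map_conj, landauGauge_neg, landauDiagAmp_neg, map_neg, Complex.conj_ofReal]

/-- **`E(−m) = E(m)` in every sector** `(N, S^z = M)` (Byers–Yang). [cite: ByersYang1961] -/
theorem minEnergyOn_hubbardTorusTT'Plaquette_neg (t' U : ℝ) (m : ℤ) (N : ℕ) (M : ℝ) :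
    (hubbardTorusTT'Plaquette L t' U (-m)).minEnergyOn (szSector N M) =
      (hubbardTorusTT'Plaquette L t' U m).minEnergyOn (szSector N M) := by
  rw [← hubbardTorusTT'Plaquette_map_conj]
  exact minEnergyOn_map_conj _ _ fun ψ h => star_mem_szSector h

/-- The sector energy is even in the flux: `plaquetteFluxEnergyTT' L t' U δ (−m) = plaquetteFluxEnergyTT' L t' U δ m`.
[cite: ByersYang1961] -/
theorem plaquetteFluxEnergyTT'_neg (t' U δ : ℝ) (m : ℤ) :
    plaquetteFluxEnergyTT' L t' U δ (-m) = plaquetteFluxEnergyTT' L t' U δ m :=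
  minEnergyOn_hubbardTorusTT'Plaquette_neg L t' U m _ _

end Literature.MathematicalPhysics.QuantumLattice
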